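import Literature.MathematicalPhysics.QuantumFieldTheory.Balaban1983to89.B8Prop6CubeMemberGaugedBdryBetaExists
import Literature.MathematicalPhysics.QuantumFieldTheory.Balaban1983to89.B8Thm4ExistsConcreteGamma
import Literature.MathematicalPhysics.QuantumFieldTheory.Balaban1983to89.B8LeafKnitZd3CubBdryBeta
import Literature.MathematicalPhysics.QuantumFieldTheory.Balaban1983to89.B8Prop6CubeMemberNormsGamma

/-!
# `Balaban1983to89.B8Prop6CubeMemberGaugedGamma` — [Balaban1985RegularSpaces] PROPOSITION 6 (p. 99), (1.135)–(1.138) AS `Node00.GaugedBoundB8` AT EVERY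
# CUBE OF NODE 00's CARRIER, FROM THEOREM 4's EXISTENCE HALF IN EDITION γ APPLIED AT THE DATUM `(1, U₀″)`, THE FOUR-LINE COLLAR SOCKET FAMILY OVER
# PRINT's SPLIT CLASS `cubeLamBP'` AND PROPOSITION 5's TWO EXISTENCE SOCKETS — the cube road's Proposition-6 assembler «D2γ»

statement-level skeleton of published theorems with citation tags; proofs where landed; nothing here is a claim about the
Yang–Mills mass gap

PDF held: `paper:balaban1985-cmp99-regular-spaces-gauge-fixing` (journal page = PDF page + 74); p. 99: *«If 7dL²Mα₀ ≤ c₁, then the assumptions of Theorem 4 are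
satisfied for the pair of configurations 1, U₀″, thus there exists a gauge transformation u such that U₁ = U₀″^{u⁻¹} satisfies the conditions (1.36)–(1.39)»*;
Theorem 4 p. 88 (existence half); Proposition 3 p. 87; Proposition 5 (1.107)–(1.108) p. 94; (1.31) p. 82; (1.59) p. 86; p. 77 (bond convention);
[B6] `[Balaban1984PropagatorsII]` (2.3) p. 224; [4] `[Balaban1985BackgroundPropagators]` Thm 3.3 p. 399.

CITATION HEADER (lean-in-tree rule).  Cell `pub-ymgap` (HUMAN RULING D-0062, Track A), DAG node N05 = [B8]; width seat `pub-ymgap-k0-s2-w1` (g0; K0⁷ stub 2 =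
[6] Prop. 6 at NODE 00's cube member; plan W-SEAT-START-LIST §k0-s2), executing dag-n05-e g9's HAND-OUT «D2γ» (bus 2026-08-27 23:16Z; dag-lead DEDUP-357 (1): one
declarer).  WHY THIS FILE.  dag-n05-e's β assembler `B8Prop6CubeMemberGaugedBdryBetaExists.gaugedBoundB8_cubeMember_of_thm4Exists_b9Dβ_d4` (p567248) takes Theorem 4's
existence half ON THE `zdGF3` CUBE SUB-FAMILY (`B8.Thm4ExistsBody …`) and the four-line socket over dag-n05-c's class `cubeLamB` — both VACUOUS at cube members
(interior shell gauge modes, certificate p572834; and, for the family form, `zdGF3.avgClose166`'s guard «box ⊂ Ω_j» — dag-n05-e LOCATED-AVG135).  EDITION γ: THIS FILE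
re-runs it with (i) Theorem 4 := dag-n05-e's member-generic CONCRETE existence half `B8Thm4ExistsConcreteGamma.thm4Exists_concrete_uniform_γ` (p584093) applied
DIRECTLY AT THE DATUM `(1, U₀″)` of p. 99 — datum laws by dag-n05-c's `B8Ineq133CubeMemberGamma.thm4_hypotheses_one_cutFixed_γ` (p584600; (1.35) in print's p. 77
guard), class `Λb := cubeLamBP'` (dag-n06-b p579891) with its γ box law and trichotomy (`B8CubeMemberLamBPrimeLaws`), boundary-layer law `bdryLayer_cubeMember`
(dag-n05-e p547598), Theorem 4's two-line (1.59) socket over `cubeLamBP'` from the all-levels four-line family by `sockH59Dβ_of_allLevelsD4β` (p547598, class-parametric);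
(ii) the norms (1.136)₂–₄ by the γ engine `B8Prop6CubeMemberNormsGamma.norms136_cubeMember_at_γ_d4` (the four-line socket at truncation `c.k`); (iii) (1.135) by
`agree135`, (1.137) inside `gaugedBoundB8_of_clauses` — verbatim.  Proposition 5's two EXISTENCE sockets and the four-line family are DISPLAYED PER CUBE; the
uniqueness socket does not occur (print's Prop. 6 needs no uniqueness, dag-n05-d).  Kind «kernel-checked proof», theorems only, no `def`.

WHAT IS PROVED (kernel, 0 sorry).
§1 ★★ `gaugedBoundB8_cubeMember_of_sockD4γ` — `∃ c₁ > 0` (on `d, L, B₀, B₀′, c_P, c_{B9}, B_∂` only) such that for every `η > 0`, every ambient `(K, {Ω_j})`, every cube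
   `c : Node00.CubeB8 d L K Ω` (ALL of NODE 00's cubes: collars `ρ ≥ L`, sides `M > 11d` — dag-n05-e LOCATED-CARRIER), GIVEN at the cube's member `(η, c.k, {□_j}, Λ′)`:
   `SockP5base`, `SockP5` at `(B₀, B₀′, c_P)` and `∀ m ≤ c.k, SockB9P3D4β L B₀ B_∂ c_{B9} η m {□_j} Λ′ (cubeLamBP' …)` — for every unitary `U₀ ∈ 𝔄_K({Ω_j}, α₀)` with
   «`7dL²·c.M·α₀ ≤ c₁`»: `GaugedBoundB8 L η U₀ c (7dL²·5dLB₀·c.M·α₀)`.  Side conditions displayed: `2 ≤ 5dLB₀` (Thm 4's logarithm device), `4B_∂ ≤ (dL − 1)B₀`.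
§2 ★ `prop6Printed_zdCub_of_sockD4γ` — the FAMILY FORM: `B8.Prop6Printed d L (5dLB₀) c₁ (zdCub ∘ f)` for every index map `f`, from the three socket families at every cube of
   every member `f j` (through `Node00.prop6Printed_zdCub_iff`) — the shape k0-s2-w1's K0 door `K0Stub2OfPrintedZdCub.prop6MemberB8At_of_prop6PrintedFamily` ∕ dag-n05-e's
   successor's junction knit «D3γ» consume.

HONEST SCOPE ∕ A6 (director-ym №189 (3)).  Composition by name; nothing of [4] or of Propositions 3∕5 is proved.  HYPOTHESES per cube: Proposition 5's ∃ base ∕ ∃ step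
sockets (N05's Prop.-5 lane; no cube-member provider in tree tonight), the all-levels four-line socket over `cubeLamBP'` ([4] Thm 3.3 with exterior data over print's class —
dag-n06-b's `B9SupplySockB9P3ZdGamma.sockB9P3D4γ_allLevels_of_thm33_on` serves it from `B9.Thm33Printed` + six member-local binders, A6-witnessed at truncation `0` by
`…nonvacuous_cubeLamBP'_zero`; `m ≥ 1` NOT witnessed — N06's object layer).  The interior shell modes of p572834 do NOT inhabit the γ socket's datum (non-zero crossing
data over print's class, dag-n05-c `B8Ineq159FlatShellModeCrossingDatum`); as every β-shaped socket it is FALSE below an absolute threshold in `B₀` (the supplier's `B₀ ≥ 1`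
absorbs it).  No joint-satisfiability claim of the three socket families beyond that.  NODE 00's `CubeB8` is wider than print's p. 98 cubes (LOCATED-CARRIER): the
sockets are asked at EVERY such cube's member, i.e. beyond print where `ρ < R₁M₁`.  Count-neutral; N05 ∕ K0⁷ stub 2 NOT discharged; one finite `𝕋⁴` programme at fixed
`ε`, Bałaban AS PRINTED; nothing continuum ∕ ℝ⁴ ∕ OS ∕ mass-gap ∕ Clay (the Yang–Mills mass gap is NOT proved by any of this; route R4 closes the conditional
finite-𝕋⁴ rung `BalabanLadder.UV` only).  No `sorry`, no `def`, no `instance`, no `notation`.  Unit `pub-ymgap-k0-s2-w1` (g0), 2026-08-27.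

RELATED IN THE TREE, NOT DUPLICATED (USED by name): `B8Prop6CubeMemberGaugedBdryBetaExists` (β assembler; imports ∕ `gaugedBoundB8_of_clauses`, `windows136_of_small`,
`agree135`, `const_136`, `smallness_134`, `localGauge_mem`), `B8Thm4ExistsConcreteGamma.thm4Exists_concrete_uniform_γ` (dag-n05-e D1γ), `B8Ineq133CubeMemberGamma.
thm4_hypotheses_one_cutFixed_γ` (dag-n05-c), `B8LeafKnitZd3CubBdryBeta.{bdryLayer_cubeMember, sockH59Dβ_of_allLevelsD4β}` (dag-n05-e), `B8LeafModelZdOfHFP.{sockP5base_anti,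
sockP5_anti}`, `B9SupplySockB9P3ZdBeta.{SockB9P3D4β, sockB9P3D4β_anti}`, `B9SupplySockB9P3ZdGamma.cubeLamBP'`, `B8CubeMemberLamBPrimeLaws`, `B8Prop6CubeMemberNormsGamma`.
-/

noncomputable section

open NormedSpace

namespace Literature.MathematicalPhysics.QuantumFieldTheory.Balaban1983to89.B8Prop6CubeMemberGaugedGamma

open MatrixLog B7Prop1Explicit B7Prop2Explicit B7Prop1Local B7Eq92Concrete
open B7Prop3Flat (c3)
open B7Prop4GeneralLevels (logCovIter linCovIter)
open B8Ineq132 (InAk inAk_gaugeAct_iff pdevOn_lt_of_inAk covDerivFwd BondTouches)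
open B8Ineq133 (cutFixed)
open B8Eq115GaugeFixing (localGauge gaugeAct_mem_of)
open B8Eq119TwistedAxial (Restr129 InAx)
open B8Eq140Level (SideTouches)
open B8Eq146AExpansion (iEta plaqCovDeriv)
open B8Eq143PlaqExpansion (pdiv)
open B8Eq155JBound (Jcur wsup)
open B8ScaledSupNorm (bondNorm msup)
open B8Eq184Proof (cfgExp)
open B8Eq138LandauZd (IsLandau138W logCfg covLap)
open B8Eq131Cubes (tcube tLo tHi ctr tLo_le_tHi)
open B8Eq131CubesAdmissible (cubeFam)
open B8CubeMemberZd (cubeLamS cubeLamB hΩ_cubeFam)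
open B8Prop6CubeMember (thm4_hypotheses_one_cutFixed)
open B8Ineq133CubeMemberGamma (thm4_hypotheses_one_cutFixed_γ)
open B8Lemma1NonAbelian (mulCfg)
open B8Prop6OfThm4 (const_136 smallness_134 localGauge_mem agree135)
open B8LeafModelZd (ZdIdx SockP5base SockP5)
open B8LeafModelZdOfHFP (sockP5base_anti sockP5_anti)
open B8LeafModelZd3 (mlogCfg)
open B8Prop6CubeMemberNormsAt (windows136_of_small)
open B8Prop6CubeMemberGauged (gaugedBoundB8_of_clauses)
open B8Prop3GaugeFixedKLevel (mem_unitaryUnits_of_mgauge_eq)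
open B8Thm4AtLandau138 (mgauge_mgauge_inv)
open B9SupplySockB9P3ZdBeta (CrossB SockB9P3D4β sockB9P3D4β_anti)
open B9SupplySockB9P3ZdGamma (cubeLamBP')
open B8LeafKnitZd3CubBdryBeta (bdryLayer_cubeMember sockH59Dβ_of_allLevelsD4β)
open B8Thm4ExistsConcreteGamma (thm4Exists_concrete_uniform_γ)
open B8CubeMemberLamBPrimeLaws (cubeLamBP'_hbox_pred cubeLamBP'_hclass)
open B8Prop6CubeMemberNormsGamma (norms136_cubeMember_at_γ_d4)
open Node00 (CubeB8 GaugedBoundB8 zdCub prop6Printed_zdCub_iff)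

-- `Site` alone could resolve to the torus sites of `Setup.lean`; re-export the `ℤ^d` sites of `B7Prop1Explicit`.
export B7Prop1Explicit (Site)

variable {d : ℕ}

variable {𝔸 : Type} [CStarAlgebra 𝔸] [Nontrivial 𝔸]

/-! ## §1 (1.135)–(1.138) at every cube from Theorem 4's existence half in edition γ AT THE DATUM + the γ socket family -/

/-- ★★ **PROPOSITION 6 (p. 99), (1.135)–(1.138) AS `Node00.GaugedBoundB8` AT EVERY CUBE OF NODE 00's CARRIER, FROM THEOREM 4's EXISTENCE HALF IN EDITION γ APPLIED AT
THE DATUM `(1, U₀″)`, THE ALL-LEVELS FOUR-LINE COLLAR SOCKET OVER PRINT's SPLIT CLASS `cubeLamBP'`, AND PROPOSITION 5's TWO EXISTENCE SOCKETS** (all three displayed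
per cube, at the cube's own member `(η, c.k, {□_j}, Λ′)`).  ONE threshold `c₁(d, L, B₀, B₀′, c_P, c_{B9}, B_∂) > 0`; for every cube `c : CubeB8 d L K Ω`, unitary
`U₀ ∈ 𝔄_K({Ω_j}, α₀)` and «`7dL²·c.M·α₀ ≤ c₁`»: `GaugedBoundB8 L η U₀ c (7dL²(5dLB₀)·c.M·α₀)`.  PROOF = print's paragraph: the datum `(1, U₀″)` satisfies Theorem 4's
hypotheses at `{□_j}` with `(α₀, α₁) ↦ (L³α₀, 6dL²Mα₀)` — (1.33), (1.34) = (1.132), `Ax`, (1.66)₀ and (1.35) = (1.133) in print's p. 77 guard (`thm4_hypotheses_one_cutFixed_γ`);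
Theorem 4's existence half in edition γ (`thm4Exists_concrete_uniform_γ`, class `cubeLamBP'` with laws `cubeLamBP'_hbox_pred` ∕ `cubeLamBP'_hclass` ∕ `bdryLayer_cubeMember`,
its (1.59) socket from the four-line family by `sockH59Dβ_of_allLevelsD4β`, Prop. 5's sockets by antitonicity to the merged threshold) gives `u` with (1.29), (1.38),
(1.62); the γ norms engine gives (1.136)₂–₄; `gaugedBoundB8_of_clauses` assembles (1.135)–(1.138).
[cite: Balaban1985RegularSpaces, Prop. 6 (1.135)–(1.138) p.99, p.99 (sentence after (1.133)), Thm 4 p.88, Prop. 3 p.87, Prop. 5 (1.107)–(1.108) p.94, (1.59) p.86, (1.31) p.82, (1.130)–(1.134) pp.98–99, p.77; Balaban1984PropagatorsII, (2.3) p.224] -/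
theorem gaugedBoundB8_cubeMember_of_sockD4γ (hd2 : 2 ≤ d) {L : ℕ} (hL : 2 ≤ L) {B₀ B₀' cP cB9 Bbd : ℝ}
    (hB₀ : 0 < B₀) (hB : 2 ≤ 5 * (d : ℝ) * L * B₀) (hB₀' : 0 < B₀') (hcP : 0 < cP) (hcB9 : 0 < cB9)
    (hBbd : 0 ≤ Bbd) (hBd : 4 * Bbd ≤ ((d : ℝ) * L - 1) * B₀) :
    ∃ c₁ : ℝ, 0 < c₁ ∧ ∀ (η : ℝ), 0 < η → ∀ {K : ℕ} {Ω : ℕ → Set (Site d)} (c : CubeB8 d L K Ω),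
      -- Proposition 5's two EXISTENCE sockets at the cube's member
      SockP5base (𝔸 := 𝔸) L B₀ B₀' cP η c.k (cubeFam false L c.a c.M c.ρ c.k) (cubeLamS L c.a c.M c.ρ c.k) →
      SockP5 (𝔸 := 𝔸) L B₀ B₀' cP η c.k (cubeFam false L c.a c.M c.ρ c.k) (cubeLamS L c.a c.M c.ρ c.k) →
      -- the all-levels four-line collar socket over PRINT's split class at the cube's member
      (∀ m, m ≤ c.k → SockB9P3D4β (𝔸 := 𝔸) L B₀ Bbd cB9 η m (cubeFam false L c.a c.M c.ρ c.k) (cubeLamS L c.a c.M c.ρ c.k)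
        (cubeLamBP' L c.a c.M c.ρ c.k)) →
      ∀ (U₀ : Site d → Fin d → 𝔸ˣ), (∀ x κ, U₀ x κ ∈ unitaryUnits 𝔸) → ∀ (α₀ : ℝ), 0 < α₀ → InAk L K η α₀ Ω U₀ →
      7 * d * (L : ℝ) ^ 2 * c.M * α₀ ≤ c₁ →
      GaugedBoundB8 L η U₀ c (7 * d * (L : ℝ) ^ 2 * (5 * (d : ℝ) * L * B₀) * c.M * α₀) := by
  have hL1 : 1 ≤ L := le_trans (by norm_num) hL
  have hd1 : 1 ≤ d := le_trans (by norm_num) hd2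
  have hLpos : (0 : ℝ) < L := by exact_mod_cast hL1
  have hLr : (1 : ℝ) ≤ L := by exact_mod_cast hL1
  have hdpos : (0 : ℝ) < d := by exact_mod_cast hd1
  -- the γ constant of the (1.61) slot
  set C₂ : ℝ := 2097152 * ((d : ℝ) + 1) ^ 2 * (L : ℝ) ^ 2 with hC₂_def
  have hC₂ : 2097152 * ((d : ℝ) + 1) ^ 2 * (L : ℝ) ^ 2 ≤ C₂ := le_rfl
  have hC₂0 : 0 ≤ C₂ := by positivity
  -- the γ norms engine and the windows (thresholds asked at `(L²α₀′, Lα₂)`: the window constant is divided by `L²`)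
  obtain ⟨c₃, hc₃, N3⟩ := norms136_cubeMember_at_γ_d4 (𝔸 := 𝔸) hd2 hL hB₀ hC₂ hcB9 hBbd hBd
  have hc₃L : 0 < c₃ / (L : ℝ) ^ 2 := by positivity
  obtain ⟨cW, hcW, W⟩ := windows136_of_small hd2 hL hB₀ hC₂0 hc₃L
  -- the merged threshold of the three sockets and Theorem 4's existence half in edition γ (ONE threshold before the data)
  set K₀ : ℝ := 2 * (L * (5 * (d : ℝ) * L * B₀)) + 8 * (8 * B₀' * (5 * (d : ℝ) * L * B₀)) with hK₀_def
  have hK₀ : 0 < K₀ := by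
    have h1 : 0 < 2 * (L * (5 * (d : ℝ) * L * B₀)) := by positivity
    have h2 : 0 ≤ 8 * (8 * B₀' * (5 * (d : ℝ) * L * B₀)) := by positivity
    linarith
  set c59 : ℝ := min cB9 (cB9 / K₀) with hc59_def
  have hc59 : 0 < c59 := lt_min hcB9 (div_pos hcB9 hK₀)
  set cPs : ℝ := min cP c59 with hcPs_def
  have hcPs : 0 < cPs := lt_min hcP hc59
  have hcPsP : cPs ≤ cP := min_le_left _ _
  have hcPs9 : cPs ≤ c59 := min_le_right _ _
  obtain ⟨c₄, hc₄, T4⟩ := thm4Exists_concrete_uniform_γ (𝔸 := 𝔸) hd2 hL hB₀ hB₀' hB hcPs hBbd hBd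
  set B : ℝ := 5 * (d : ℝ) * L * B₀ with hB_def
  have hB0 : 0 < B := by positivity
  set C : ℝ := 131072 * ((d : ℝ) + 1) ^ 2 with hC_def
  have hC0 : 0 < C := by positivity
  refine ⟨min c₄ (min cW (1 / (16 * C * B))), lt_min hc₄ (lt_min hcW (by positivity)), ?_⟩
  intro η hη K Ω c SP5base SP5 SB9 U₀ hU₀ α₀ hα hAK hs
  -- the cube's laws as datum binders
  have hk : 1 ≤ c.k := c.one_le_k
  have hρL : L ≤ c.ρ := c.L_le_ρ
  have hρM : c.ρ ≤ c.M := c.ρ_le_M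
  have hρ : 1 ≤ c.ρ := hL1.trans hρL
  have hM1 : 1 ≤ c.M := hρ.trans hρM
  have hM : 11 * (d : ℝ) < c.M := by exact_mod_cast c.big
  have hLdM : (L : ℝ) ≤ d * c.M := by exact_mod_cast c.L_le_dM
  have hA : InAk L c.k η α₀ Ω U₀ := c.inAk hAK
  have hs₄ : 7 * d * (L : ℝ) ^ 2 * c.M * α₀ ≤ c₄ := hs.trans (min_le_left _ _)
  have hsW : 7 * d * (L : ℝ) ^ 2 * c.M * α₀ ≤ cW := hs.trans ((min_le_right _ _).trans (min_le_left _ _))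
  have hsC : 7 * d * (L : ℝ) ^ 2 * c.M * α₀ ≤ 1 / (16 * C * B) := hs.trans ((min_le_right _ _).trans (min_le_right _ _))
  -- every window from «7dL²Mα₀ ≤ c₁»
  obtain ⟨⟨hα3, hα2, hsmall⟩, ⟨hα₀c, hα₁c, hα₂c⟩, h61, ⟨-, -, h16, -, hc3α, hsmall₁⟩, h12⟩ := W c.M c.ρ hM1 hρM hM hLdM α₀ hα hsW
  -- the shifted smallness pair `(α₀′, α₁′) = (L³α₀, 6dL²Mα₀)` and `t = α₀′ + α₁′`
  have hα₀' : 0 < (L : ℝ) ^ 3 * α₀ := by positivity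
  have hMpos : (0 : ℝ) < c.M := by exact_mod_cast hM1
  have hα₁' : 0 < 6 * d * (L : ℝ) ^ 2 * c.M * α₀ := by positivity
  have ht₄ : (L : ℝ) ^ 3 * α₀ + 6 * d * (L : ℝ) ^ 2 * c.M * α₀ ≤ c₄ := smallness_134 hLpos hα hLdM hs₄
  have hα₂pos : 0 < B * ((L : ℝ) ^ 3 * α₀ + 6 * d * (L : ℝ) ^ 2 * c.M * α₀) := mul_pos hB0 (add_pos hα₀' hα₁')
  -- the γ thresholds `L²α₀′ ≤ c₃`, `L·α₂ ≤ c₃`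
  have hL2 : (0 : ℝ) < (L : ℝ) ^ 2 := by positivity
  have hγ₀ : (L : ℝ) ^ 2 * ((L : ℝ) ^ 3 * α₀) ≤ c₃ := by
    have h := mul_le_mul_of_nonneg_left hα₀c hL2.le
    rwa [mul_div_cancel₀ _ hL2.ne'] at h
  have hγ₂ : (L : ℝ) * (5 * (d : ℝ) * L * B₀ * ((L : ℝ) ^ 3 * α₀ + 6 * d * (L : ℝ) ^ 2 * c.M * α₀)) ≤ c₃ := by
    calc (L : ℝ) * (5 * (d : ℝ) * L * B₀ * ((L : ℝ) ^ 3 * α₀ + 6 * d * (L : ℝ) ^ 2 * c.M * α₀))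
        ≤ (L : ℝ) * (c₃ / (L : ℝ) ^ 2) := mul_le_mul_of_nonneg_left hα₂c hLpos.le
      _ = c₃ / (L : ℝ) := by field_simp
      _ ≤ c₃ := div_le_self hc₃.le hLr
  -- «the assumptions of Theorem 4 are satisfied for the pair 1, U₀″» — (1.35) in PRINT's guard (dag-n05-c γ)
  obtain ⟨hmem, h33, h34, hAx, h135γ, h66⟩ :=
    thm4_hypotheses_one_cutFixed_γ L hL hd1 c.k U₀ hU₀ hα hα3 hα2 c.a hρ hρM hM hη hA c.tcube_sub hsmall
  set U'' := cutFixed L (tLo c.a c.ρ) (tHi c.a c.M c.ρ) U₀ c.k (ctr c.a c.M) with hU''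
  have hone : ∀ x κ, (1 : Site d → Fin d → 𝔸ˣ) x κ ∈ unitaryUnits 𝔸 := fun _ _ => (unitaryUnits 𝔸).one_mem
  -- THEOREM 4 (existence half, edition γ) at the cube's member `({□_j}, Λ′, cubeLamBP')`, for the datum `(1, U₀″)` at `(α₀′, α₁′)`
  have ht₄' : (L : ℝ) ^ 3 * α₀ + 6 * d * (L : ℝ) ^ 2 * c.M * α₀ ≤ c₄ := ht₄
  obtain ⟨u, hu, huS, h129, hLan, h162⟩ :=
    T4 η hη c.k (cubeFam false L c.a c.M c.ρ c.k) (hΩ_cubeFam hL1 c.a c.M hρL c.k) (cubeLamS L c.a c.M c.ρ c.k) (cubeLamBP' L c.a c.M c.ρ c.k)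
      (cubeLamBP'_hbox_pred hL1 c.a c.M hρL c.k) (cubeLamBP'_hclass hL1 c.a c.M hρL c.k) (bdryLayer_cubeMember hL c.a c.M c.ρ c.k hρL hk)
      (sockP5base_anti hcPsP SP5base) (sockP5_anti hcPsP SP5)
      (fun α₀ α₁ hα₀ hα₁ hle => sockH59Dβ_of_allLevelsD4β hd1 hL1 hB₀ hB₀'.le hcB9 SB9 α₀ α₁ hα₀ hα₁ (hle.trans hcPs9))
      ((L : ℝ) ^ 3 * α₀) (6 * d * (L : ℝ) ^ 2 * c.M * α₀) hα₀' hα₁' ht₄' 1 U'' hone hmem h33 h34 hAx h135γ h66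
  -- the gauge-fixed field `U₁ = U₀″^{u⁻¹}` (at background `1` the moving-frame action is the ordinary gauge action)
  have hLan' : IsLandau138W L c.k η (cubeFam false L c.a c.M c.ρ c.k 0) (cubeLamS L c.a c.M c.ρ c.k c.k) (1 : Site d → Fin d → 𝔸ˣ)
      (gaugeAct u⁻¹ U'') := by
    have h := hLan hk
    rw [mgauge_one_left] at h
    exact h
  have h162' : ∀ j, j ≤ c.k → ∀ b ∈ {b : Site d × Fin d | SideTouches (cubeFam false L c.a c.M c.ρ c.k j) b.1 b.2},
      gaugeAct u⁻¹ U'' b.1 b.2 = cfgExp η (logCfg η (gaugeAct u⁻¹ U'')) b.1 b.2 ∧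
        IsSelfAdjoint (logCfg η (gaugeAct u⁻¹ U'') b.1 b.2) ∧
        ‖logCfg η (gaugeAct u⁻¹ U'') b.1 b.2‖ ≤
          (5 * (d : ℝ) * L * B₀ * ((L : ℝ) ^ 3 * α₀ + 6 * d * (L : ℝ) ^ 2 * c.M * α₀)) * ((L : ℝ) ^ j * η)⁻¹ := by
    have h := h162
    simp only [mgauge_one_left] at h
    exact h
  -- PROPOSITION 3's norm members at the member FROM THE FOUR-LINE SOCKET OVER THE SPLIT CLASS AT TRUNCATION `c.k` (the γ engine)
  obtain ⟨h136g, h139j, h139l⟩ := N3 η hη c.k hk c.a c.M c.ρ hρL hρM hM (SB9 c.k le_rfl) U₀ hU₀ α₀ hα hα3 hα2 Ω hA c.tcube_sub hsmall hγ₀ hγ₂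
    h61 hsmall₁ u hu huS h129 hLan' h162'
  -- the three norm members of (1.136), with print's constant (`const_136`)
  have hconst : B * ((L : ℝ) ^ 3 * α₀ + 6 * d * (L : ℝ) ^ 2 * c.M * α₀) ≤ 7 * d * (L : ℝ) ^ 2 * B * c.M * α₀ :=
    const_136 hLpos hα hB0.le hLdM
  have h136₂ : B8ScaledSupNorm.msup L c.k η (-(2 : ℝ)) (fun j (t : Fin d × Fin d × Site d) => SideTouches (cubeFam false L c.a c.M c.ρ c.k j) t.2.2 t.2.1)
      (fun t => B8Ineq132.covDerivFwd η (1 : Site d → Fin d → 𝔸ˣ) t.1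
        (fun z => mlogCfg c.k η (cubeFam false L c.a c.M c.ρ c.k) (gaugeAct u⁻¹ U'') z t.2.1) t.2.2) ≤
      7 * d * (L : ℝ) ^ 2 * (5 * (d : ℝ) * L * B₀) * c.M * α₀ := h136g.trans hconst
  have h136₃ : B8ScaledSupNorm.bondNorm L c.k η (-(3 : ℝ)) (cubeFam false L c.a c.M c.ρ c.k)
      (fun x μ => B8Eq143PlaqExpansion.pdiv η (1 : Site d → Fin d → 𝔸ˣ) (B8Eq146AExpansion.plaqCovDeriv η (1 : Site d → Fin d → 𝔸ˣ)
        (mlogCfg c.k η (cubeFam false L c.a c.M c.ρ c.k) (gaugeAct u⁻¹ U''))) μ x) ≤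
      7 * d * (L : ℝ) ^ 2 * (5 * (d : ℝ) * L * B₀) * c.M * α₀ := h139j.trans hconst
  have h136₄ : B8ScaledSupNorm.bondNorm L c.k η (-(3 : ℝ)) (cubeFam false L c.a c.M c.ρ c.k)
      (fun x μ => B8Eq138LandauZd.covLap η (1 : Site d → Fin d → 𝔸ˣ)
        (fun z => mlogCfg c.k η (cubeFam false L c.a c.M c.ρ c.k) (gaugeAct u⁻¹ U'') z μ) x) ≤
      7 * d * (L : ℝ) ^ 2 * (5 * (d : ℝ) * L * B₀) * c.M * α₀ := h139l.trans hconst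
  -- (1.135): `w = v⁻¹u` is unitary and `U₀^{w⁻¹} = U₁` on `□̃`
  have hΩ' : ∃ l, l ≤ c.k ∧ c.k ≤ l + 1 ∧ ∀ x, InBox (B8Ineq130.tlo L (tLo c.a c.ρ) c.k) (B8Ineq130.thi L (tHi c.a c.M c.ρ) c.k) x → x ∈ Ω l :=
    ⟨c.k - 1, Nat.sub_le _ _, by omega, fun x hx => c.tcube_sub hx⟩
  have hvG : ∀ x, localGauge L (tLo c.a c.ρ) (tHi c.a c.M c.ρ) U₀ c.k (ctr c.a c.M) x ∈ unitaryUnits 𝔸 :=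
    localGauge_mem L hL (avgClosed_unitaryUnits (𝔸 := 𝔸) d L) c.k U₀ hU₀ hα hα3 hα2 (tLo_le_tHi hM1)
      (pdevOn_lt_of_inAk hL1 hα hA hΩ') (ctr c.a c.M)
  have hw : ∀ x, ((localGauge L (tLo c.a c.ρ) (tHi c.a c.M c.ρ) U₀ c.k (ctr c.a c.M))⁻¹ * u) x ∈ unitaryUnits 𝔸 := fun x =>
    (unitaryUnits 𝔸).mul_mem ((unitaryUnits 𝔸).inv_mem (hvG x)) (hu x)
  have h135 := agree135 (B8Ineq130.tlo L (tLo c.a c.ρ) c.k) (B8Ineq130.thi L (tHi c.a c.M c.ρ) c.k) U₀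
    (localGauge L (tLo c.a c.ρ) (tHi c.a c.M c.ρ) U₀ c.k (ctr c.a c.M)) u
  -- the [3]-Prop.-4 window of the engine
  have h16C : 16 * (131072 * ((d : ℝ) + 1) ^ 2) * (B * ((L : ℝ) ^ 3 * α₀ + 6 * d * (L : ℝ) ^ 2 * c.M * α₀)) ≤ 1 := by
    have e3 : B * (7 * d * (L : ℝ) ^ 2 * c.M * α₀) ≤ B * (1 / (16 * C * B)) := mul_le_mul_of_nonneg_left hsC hB0.le
    have e4 : B * (1 / (16 * C * B)) = 1 / (16 * C) := by field_simp
    have e2 : 7 * d * (L : ℝ) ^ 2 * B * c.M * α₀ = B * (7 * d * (L : ℝ) ^ 2 * c.M * α₀) := by ring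
    have e5 : B * ((L : ℝ) ^ 3 * α₀ + 6 * d * (L : ℝ) ^ 2 * c.M * α₀) ≤ 1 / (16 * C) := by linarith [hconst, e3]
    calc 16 * (131072 * ((d : ℝ) + 1) ^ 2) * (B * ((L : ℝ) ^ 3 * α₀ + 6 * d * (L : ℝ) ^ 2 * c.M * α₀))
        ≤ 16 * C * (1 / (16 * C)) := mul_le_mul_of_nonneg_left e5 (by positivity)
      _ = 1 := by field_simp
  exact gaugedBoundB8_of_clauses hd2 hL hB₀ hη c U₀ hU₀ hα hA hα3 hα2 hsmall h12 h16C hc3α u hu huS h129 hLan' h162' hw h135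
    h136₂ h136₃ h136₄

#print axioms gaugedBoundB8_cubeMember_of_sockD4γ

/-! ## §2 The family form on NODE 00's member `zdCub` -/

/-- ★ **`B8.Prop6Printed d L (5dLB₀) c₁` ON `Node00.zdCub ∘ f` FROM THE THREE SOCKET FAMILIES AT EVERY CUBE OF EVERY MEMBER** (`gaugedBoundB8_cubeMember_of_sockD4γ`
through `Node00.prop6Printed_zdCub_iff`): for every index map `f : ι → ZdIdx d L`, if at every cube `c : CubeB8 d L (f j).k (f j).Ω` the member `((f j).η, c.k, {□_j}, Λ′)`
carries `SockP5base`, `SockP5` at `(B₀, B₀′, c_P)` and the all-levels four-line socket over `cubeLamBP'`, then `B8.Prop6Printed d L (5dLB₀) c₁ (fun j => zdCub 𝔸 L (f j))` —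
the shape of k0-s2-w1's K0 door `prop6MemberB8At_of_prop6PrintedFamily` ∕ `…_of_gaugedBoundB8` (p584116) and of the junction knit «D3γ».
[cite: Balaban1985RegularSpaces, Prop. 6 p.99, Thm 4 p.88, Prop. 3 p.87, Prop. 5 (1.107)–(1.108) p.94, (1.59) p.86, (1.31) p.82] -/
theorem prop6Printed_zdCub_of_sockD4γ (hd2 : 2 ≤ d) {L : ℕ} (hL : 2 ≤ L) {B₀ B₀' cP cB9 Bbd : ℝ}
    (hB₀ : 0 < B₀) (hB : 2 ≤ 5 * (d : ℝ) * L * B₀) (hB₀' : 0 < B₀') (hcP : 0 < cP) (hcB9 : 0 < cB9)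
    (hBbd : 0 ≤ Bbd) (hBd : 4 * Bbd ≤ ((d : ℝ) * L - 1) * B₀) :
    ∃ c₁ : ℝ, 0 < c₁ ∧ ∀ {ι : Type} (f : ι → ZdIdx d L),
      (∀ (j : ι) (c : CubeB8 d L (f j).k (f j).Ω),
        SockP5base (𝔸 := 𝔸) L B₀ B₀' cP (f j).η c.k (cubeFam false L c.a c.M c.ρ c.k) (cubeLamS L c.a c.M c.ρ c.k) ∧
        SockP5 (𝔸 := 𝔸) L B₀ B₀' cP (f j).η c.k (cubeFam false L c.a c.M c.ρ c.k) (cubeLamS L c.a c.M c.ρ c.k) ∧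
        (∀ m, m ≤ c.k → SockB9P3D4β (𝔸 := 𝔸) L B₀ Bbd cB9 (f j).η m (cubeFam false L c.a c.M c.ρ c.k) (cubeLamS L c.a c.M c.ρ c.k)
          (cubeLamBP' L c.a c.M c.ρ c.k))) →
      B8.Prop6Printed d (L : ℝ) (5 * (d : ℝ) * L * B₀) c₁ (fun j => zdCub 𝔸 L (f j)) := by
  obtain ⟨c₁, hc₁, G⟩ := gaugedBoundB8_cubeMember_of_sockD4γ (𝔸 := 𝔸) hd2 hL hB₀ hB hB₀' hcP hcB9 hBbd hBd
  refine ⟨c₁, hc₁, fun f S => ?_⟩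
  rw [prop6Printed_zdCub_iff]
  intro j α₀ hα U₀ hInA c hs
  obtain ⟨S1, S2, S3⟩ := S j c
  exact G (f j).η (f j).hη c S1 S2 S3 U₀.1 U₀.2 α₀ hα hInA hs

#print axioms prop6Printed_zdCub_of_sockD4γ

end Literature.MathematicalPhysics.QuantumFieldTheory.Balaban1983to89.B8Prop6CubeMemberGaugedGamma

end
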